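import Mathlib.MeasureTheory.Integral.Bochner.Basic
import Mathlib.MeasureTheory.Integral.IntegrableOn

/-!
# Average first: replacing an observable by its Cesàro average along a commuting symmetry

Helper file for the crux `QuadrupoleSelectionRule` (stmt-CriticalPhenomena-7029), route
`CardyFlipRusso`, sub-problem `CardyFormulaZ2`, line `Sketch` generation 2 ("TransferR2"),
stub T2 "average first".

If a finite measure `M` on `Θ` is invariant under a measurable map `g` (`g_* M = M`) and `g`
commutes with a measurable map `σ` (the role shift), then the push-forward `σ_* M` is also
`g`-invariant, and hence the pairing of the signed measure `σ_* M − M` with a bounded measurable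
observable `f` equals its pairing with the Cesàro average
`f̄ = (m + 1)⁻¹ ∑_{k=0}^{m} f ∘ g^[k]` of `f` along the first `m + 1` iterates of `g`:

`∫ f d(σ_* M) − ∫ f dM = ∫ f̄ d(σ_* M) − ∫ f̄ dM`.

All statements are elementary measure theory (push-forwards and `integral_map`).
-/

noncomputable section

open MeasureTheory

namespace Summit.CriticalPhenomena.CardyFormulaZ2.Theorems

variable {Θ : Type*} [MeasurableSpace Θ]

/-- A measure invariant under a measurable map `g` is invariant under every iterate `g^[k]`.
[folklore] -/
theorem map_iterate_eq_self_of_map_eq (M : Measure Θ) (g : Θ → Θ) (hg : Measurable g)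
    (hM : M.map g = M) (k : ℕ) : M.map (g^[k]) = M := by
  induction k with
  | zero => simp
  | succ k ih =>
    rw [Function.iterate_succ', ← Measure.map_map hg (hg.iterate k), ih, hM]

/-- Under a `g`-invariant measure, composing a measurable real observable with an iterate of `g`
does not change its integral. [folklore] -/
theorem integral_comp_iterate_eq_of_map_eq (M : Measure Θ) (g : Θ → Θ) (hg : Measurable g)
    (hM : M.map g = M) (f : Θ → ℝ) (hf : Measurable f) (k : ℕ) :
    ∫ θ, f (g^[k] θ) ∂M = ∫ θ, f θ ∂M := by
  calc ∫ θ, f (g^[k] θ) ∂M = ∫ θ, f θ ∂(M.map (g^[k])) :=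
        (integral_map (hg.iterate k).aemeasurable hf.aestronglyMeasurable).symm
    _ = ∫ θ, f θ ∂M := by rw [map_iterate_eq_self_of_map_eq M g hg hM k]

/-- If `g_* M = M` and `g` commutes with `σ`, then the push-forward `σ_* M` is `g`-invariant as
well: `g_* σ_* M = (g ∘ σ)_* M = (σ ∘ g)_* M = σ_* g_* M = σ_* M`. [folklore] -/
theorem map_map_eq_map_of_commute (M : Measure Θ) (g σ : Θ → Θ) (hg : Measurable g)
    (hσ : Measurable σ) (hM : M.map g = M) (hcomm : ∀ θ, g (σ θ) = σ (g θ)) :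
    (M.map σ).map g = M.map σ := by
  have h : g ∘ σ = σ ∘ g := funext hcomm
  rw [Measure.map_map hg hσ, h, ← Measure.map_map hσ hg, hM]

/-- Under a finite `g`-invariant measure, the Cesàro average
`(m + 1)⁻¹ ∑_{k=0}^{m} f ∘ g^[k]` of a bounded measurable real observable `f` has the same integral
as `f`. [folklore] -/
theorem integral_cesaro_eq_of_map_eq (M : Measure Θ) [IsFiniteMeasure M] (g : Θ → Θ)
    (hg : Measurable g) (hM : M.map g = M) (f : Θ → ℝ) (hf : Measurable f)
    (hfb : ∃ C, ∀ θ, |f θ| ≤ C) (m : ℕ) :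
    ∫ θ, (∑ k ∈ Finset.range (m + 1), f (g^[k] θ)) / (m + 1 : ℝ) ∂M = ∫ θ, f θ ∂M := by
  obtain ⟨C, hC⟩ := hfb
  have hint : ∀ k ∈ Finset.range (m + 1), Integrable (fun θ => f (g^[k] θ)) M := by
    intro k _
    refine Integrable.of_bound (hf.comp (hg.iterate k)).aestronglyMeasurable C
      (ae_of_all _ fun θ => ?_)
    simpa only [Real.norm_eq_abs] using hC (g^[k] θ)
  rw [integral_div, integral_finsetSum _ hint]
  simp_rw [integral_comp_iterate_eq_of_map_eq M g hg hM f hf]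
  rw [Finset.sum_const, Finset.card_range, nsmul_eq_mul]
  have hm : (m + 1 : ℝ) ≠ 0 := by positivity
  push_cast
  field_simp

/-- **Average first** (stub T2 of line `Sketch`, generation 2, for the crux
`QuadrupoleSelectionRule`).  If the arrival measure `M` is invariant under `g` and `g` commutes
with the role shift `σ`, the pairing of `σ_* M − M` with a bounded measurable observable `f`
equals its pairing with the Cesàro average of `f` along the first `m + 1` iterates of `g`.
[folklore] -/
theorem integral_map_sub_integral_eq_cesaro {Θ : Type*} [MeasurableSpace Θ] (M : Measure Θ)
    [IsFiniteMeasure M] (g σ : Θ → Θ) (hg : Measurable g) (hσ : Measurable σ) (hM : M.map g = M)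
    (hcomm : ∀ θ, g (σ θ) = σ (g θ)) (f : Θ → ℝ) (hf : Measurable f) (hfb : ∃ C, ∀ θ, |f θ| ≤ C)
    (m : ℕ) :
    (∫ θ, f θ ∂(M.map σ)) - ∫ θ, f θ ∂M =
      (∫ θ, (∑ k ∈ Finset.range (m + 1), f (g^[k] θ)) / (m + 1 : ℝ) ∂(M.map σ)) -
        ∫ θ, (∑ k ∈ Finset.range (m + 1), f (g^[k] θ)) / (m + 1 : ℝ) ∂M := by
  have hσM : (M.map σ).map g = M.map σ := map_map_eq_map_of_commute M g σ hg hσ hM hcomm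
  rw [integral_cesaro_eq_of_map_eq (M.map σ) g hg hσM f hf hfb m,
    integral_cesaro_eq_of_map_eq M g hg hM f hf hfb m]

end Summit.CriticalPhenomena.CardyFormulaZ2.Theorems

end
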